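import Summits.AtomisticToContinuum.HydrodynamicLimit.Theorems.BoxDissipativeWeakStrongLocalGibbsFineScaleStatics
import Summits.AtomisticToContinuum.HydrodynamicLimit.Theorems.BoxDissipativeWeakStrongLocalGibbsFineScaleDensityL1

/-!
# `LocalGibbsFineScale` (route `BoxDissipativeWeakStrong`), file 9: the fine-scale law of large
numbers for local Gibbs states — assembly of the statics

Support theorem for item stmt-AtomisticToContinuum-9905 (`statics_kernel`): for continuous profiles
`a₀, θ₀ > 0`, `u₀`, a reduced density `σ ≤ 1/2` in the cluster-expansion regime
(`SmallDensity (profileOf a₀) σ`) and a family of averaging kernels `g_N(x, ·)` (jointly measurable,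
`0 ≤ g_N ≤ C_N`, unit mass, supported in the sup-ball of radius `r_N → 0`, kinetic window
`C_N/(N+1) → 0`),

  `∫ (∫ₓ |ρ̂_N(x) - ρ₀(x)| + ‖m̂_N(x) - ρ₀(x)u₀(x)‖ + |Ê_N(x) - E(ρ₀,u₀,θ₀)(x)| dx) dP_N → 0`,

`P_N = localGibbsMeasure σ a₀ u₀ θ₀ N`, `ρ₀ = rhoLim (profileOf a₀) σ`, the outer integral being the
lower Lebesgue integral of `ofReal` of the inner Bochner integral (as in the route statement).
Proof: `ofReal ∫ₓ ≤ ∫⁻ₓ ofReal`, Tonelli, and the per-centre bounds of file 8 made uniform in the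
centre by the uniform `L¹` density law of file 5 and the moduli of continuity of `u₀`,
`|u₀|²/2 + 3θ₀/2`.
-/

noncomputable section

namespace Summit.AtomisticToContinuum.HydrodynamicLimit.Theorems
namespace LGFS
open MeasureTheory ProbabilityTheory Finset Filter Topology Metric
open Literature.Probability.LatticeModels Literature.MathematicalPhysics.StatisticalMechanics
  Literature.MathematicalPhysics.KineticTheory
open Literature.Analysis.FluidPDE (Config)
open scoped ENNReal

variable {a₀ θ₀ : T3 → ℝ} {u₀ : T3 → V3}

/-- `totalEnergyDensity ρ u θ = ρ (|u|²/2 + (card Fin 3) θ / 2)`. -/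
theorem totalEnergyDensity_eq (ρ : ℝ) (u : V3) (θ : ℝ) :
    totalEnergyDensity ρ u θ = ρ * (‖u‖ ^ 2 / 2 + Fintype.card (Fin 3) * θ / 2) := by
  rw [totalEnergyDensity, Fintype.card_fin]; push_cast; ring

/-- `ofReal (∫ f) ≤ ∫⁻ ofReal ∘ f` for `f ≥ 0` (equality if `f` is integrable, and the Bochner
integral is `0` otherwise). -/
theorem ofReal_integral_le_lintegral_ofReal' {α : Type*} [MeasurableSpace α] {μ : Measure α}
    {f : α → ℝ} (hf : ∀ x, 0 ≤ f x) : ENNReal.ofReal (∫ x, f x ∂μ) ≤ ∫⁻ x, ENNReal.ofReal (f x) ∂μ := by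
  by_cases hfi : Integrable f μ
  · rw [ofReal_integral_eq_lintegral_ofReal hfi (ae_of_all _ hf)]
  · rw [integral_undef hfi, ENNReal.ofReal_zero]; exact zero_le

/-- A continuous real function on `𝕋³` is bounded above. -/
theorem exists_forall_le_of_continuous {f : T3 → ℝ} (hf : Continuous f) : ∃ C : ℝ, 0 ≤ C ∧ ∀ x, f x ≤ C := by
  obtain ⟨C, hC0, hC⟩ := exists_forall_abs_le_of_continuous hf
  exact ⟨C, hC0, fun x => (le_abs_self _).trans (hC x)⟩

/-- `E_{posGibbs} |(N+1)⁻¹ ∑ g_N(x, qᵢ) - ρ₀(x)| ≤ δ` eventually, uniformly in `x` (file 5, through the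
bridge `posGibbsMeasure_eq`). -/
theorem integral_abs_avg_sub_posGibbs_eventually (ha : Continuous a₀) (ha0 : ∀ x, 0 < a₀ x) {σ : ℝ}
    (hs : SmallDensity (profileOf a₀ ha ha0) σ) {g : ℕ → T3 → T3 → ℝ} {Cg r : ℕ → ℝ}
    (hgm : ∀ N x, Measurable (g N x)) (hg0 : ∀ N x y, 0 ≤ g N x y) (hgC : ∀ N x y, g N x y ≤ Cg N)
    (hg1 : ∀ N x, ∫ y, g N x y = 1) (hsupp : ∀ N x y, g N x y ≠ 0 → dist y x < r N)
    (hr : Tendsto r atTop (𝓝 0)) (hwin : Tendsto (fun N : ℕ => Cg N / ((N : ℝ) + 1)) atTop (𝓝 0))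
    {δ : ℝ} (hδ : 0 < δ) :
    ∀ᶠ N in atTop, ∀ x,
      ∫ q, |((((N + 1 : ℕ) : ℝ))⁻¹ * ∑ i, g N x (q i)) - rhoLim (profileOf a₀ ha ha0) σ x|
        ∂posGibbsMeasure a₀ (hsDiameter σ N) (N + 1) ≤ δ := by
  filter_upwards [density_L1_kernel_uniform hs hgm hg0 hgC hg1 hsupp hr hwin hδ] with N hN x
  rw [posGibbsMeasure_eq ha ha0]
  have h := hN x
  rw [XiN] at h
  exact h

/-- **The fine-scale law of large numbers for local Gibbs states (statics).** See the module
docstring. -/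
theorem statics_kernel (ha : Continuous a₀) (hθ : Continuous θ₀) (hu : Continuous u₀)
    (ha0 : ∀ x, 0 < a₀ x) (hθ0 : ∀ x, 0 < θ₀ x) {σ : ℝ} (hσ2 : σ ≤ 1 / 2)
    (hs : SmallDensity (profileOf a₀ ha ha0) σ) {g : ℕ → T3 → T3 → ℝ} {Cg r : ℕ → ℝ}
    (hgj : ∀ N, Measurable fun p : T3 × T3 => g N p.1 p.2)
    (hg0 : ∀ N x y, 0 ≤ g N x y) (hgC : ∀ N x y, g N x y ≤ Cg N) (hg1 : ∀ N x, ∫ y, g N x y = 1)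
    (hsupp : ∀ N x y, g N x y ≠ 0 → dist y x < r N) (hr : Tendsto r atTop (𝓝 0))
    (hwin : Tendsto (fun N : ℕ => Cg N / ((N : ℝ) + 1)) atTop (𝓝 0)) :
    Tendsto (fun N : ℕ => ∫⁻ z, ENNReal.ofReal (∫ x,
        (|empiricalDensityField z (g N x) - rhoLim (profileOf a₀ ha ha0) σ x| +
         ‖empiricalMomentumField z (g N x) - rhoLim (profileOf a₀ ha ha0) σ x • u₀ x‖ +
         |empiricalEnergyField z (g N x) -
            totalEnergyDensity (rhoLim (profileOf a₀ ha ha0) σ x) (u₀ x) (θ₀ x)|))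
      ∂localGibbsMeasure σ a₀ u₀ θ₀ N) atTop (𝓝 0) := by
  set P := profileOf a₀ ha ha0 with hP
  set ρ₀ := rhoLim P σ with hρ₀
  have hM := P.M_pos
  have hρc : Continuous ρ₀ := hs.continuous_rhoLim
  have hgm : ∀ N x, Measurable (g N x) := fun N x => (hgj N).comp (measurable_const.prodMk measurable_id)
  -- constants
  obtain ⟨Θ, hΘ0, hΘ⟩ := exists_forall_le_of_continuous hθ
  obtain ⟨U, hU0, hU⟩ := exists_forall_le_of_continuous (continuous_norm.comp hu)
  set e : T3 → ℝ := fun y => ‖u₀ y‖ ^ 2 / 2 + Fintype.card (Fin 3) * θ₀ y / 2 with he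
  have hec : Continuous e := by rw [he]; fun_prop
  obtain ⟨Ee, hEe0, hEe⟩ := exists_forall_abs_le_of_continuous hec
  set Bf : T3 → ℝ := fun y => 2 * 3 * θ₀ y * ‖u₀ y‖ ^ 2 + θ₀ y ^ 2 / 2 * gaussFourthMomentConst (Fin 3) with hBf
  have hBc : Continuous Bf := by rw [hBf]; fun_prop
  obtain ⟨B, hB0, hB⟩ := exists_forall_le_of_continuous hBc
  -- reduction to: `∀ ε > 0, ∀ᶠ N, LHS ≤ ofReal ε`
  rw [ENNReal.tendsto_nhds_zero]
  intro ε' hε'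
  rcases eq_or_ne ε' ⊤ with hε't | hε't
  · exact Eventually.of_forall fun N => hε't ▸ le_top
  have hεpos : 0 < ε'.toReal := ENNReal.toReal_pos hε'.ne' hε't
  set ε := ε'.toReal with hε
  rw [← ENNReal.ofReal_toReal hε't]
  -- the small constants
  obtain ⟨δ₀, hδ₀, hδ₀le⟩ := exists_pos_mul_le (ε := ε / 4) (K := 1 + 3 * U + Ee) (by positivity) (by positivity)
  obtain ⟨τ₁, hτ₁, hτ₁le⟩ := exists_pos_mul_le (ε := ε / 8) (K := 3 * (2 * P.M)) (by positivity) (by positivity)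
  obtain ⟨τ₂, hτ₂, hτ₂le⟩ := exists_pos_mul_le (ε := ε / 8) (K := 2 * P.M) (by positivity) (by positivity)
  obtain ⟨ϑ₁, hϑ₁, hϑ₁f⟩ := Metric.uniformContinuous_iff.1 (CompactSpace.uniformContinuous_of_continuous hu) τ₁ hτ₁
  obtain ⟨ϑ₂, hϑ₂, hϑ₂f⟩ := Metric.uniformContinuous_iff.1 (CompactSpace.uniformContinuous_of_continuous hec) τ₂ hτ₂
  -- eventual conditions
  have hE1 := integral_abs_avg_sub_posGibbs_eventually ha ha0 hs hgm hg0 hgC hg1 hsupp hr hwin hδ₀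
  have hE2 : ∀ᶠ N in atTop, r N < min ϑ₁ ϑ₂ := hr.eventually (gt_mem_nhds (lt_min hϑ₁ hϑ₂))
  have hsqrt : ∀ K : ℝ, 0 ≤ K → Tendsto (fun N : ℕ => Real.sqrt ((((N + 1 : ℕ) : ℝ))⁻¹ * Cg N * K)) atTop (𝓝 0) := by
    intro K hK
    have h1 : Tendsto (fun N : ℕ => (((N + 1 : ℕ) : ℝ))⁻¹ * Cg N * K) atTop (𝓝 0) := by
      have := hwin.mul_const K
      rw [zero_mul] at this
      refine this.congr fun N => ?_
      push_cast; ring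
    have h2 := (Real.continuous_sqrt.tendsto 0).comp h1
    rwa [Function.comp_def, Real.sqrt_zero] at h2
  have hE3 : ∀ᶠ N : ℕ in atTop, 3 * (Real.sqrt ((((N + 1 : ℕ) : ℝ))⁻¹ * Cg N * Θ) * (1 + 2 * P.M) / 2) ≤ ε / 8 := by
    have h := ((hsqrt Θ hΘ0).mul_const ((1 + 2 * P.M) / 2)).const_mul 3
    rw [zero_mul, mul_zero] at h
    refine (h.eventually (ge_mem_nhds (by positivity : (0 : ℝ) < ε / 8))).mono fun N hN => ?_
    refine le_trans (le_of_eq ?_) hN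
    ring
  have hE4 : ∀ᶠ N : ℕ in atTop, Real.sqrt ((((N + 1 : ℕ) : ℝ))⁻¹ * Cg N * B) * (1 + 2 * P.M) / 2 ≤ ε / 8 := by
    have h := (hsqrt B hB0).mul_const ((1 + 2 * P.M) / 2)
    rw [zero_mul] at h
    refine (h.eventually (ge_mem_nhds (by positivity : (0 : ℝ) < ε / 8))).mono fun N hN => ?_
    refine le_trans (le_of_eq ?_) hN
    ring
  filter_upwards [hE1, hE2, hE3, hE4] with N hN1 hN2 hN3 hN4
  -- fix `N`; abbreviations
  set LG := localGibbsMeasure σ a₀ u₀ θ₀ N with hLG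
  haveI : IsProbabilityMeasure LG := isProbabilityMeasure_localGibbsMeasure ha hθ hu ha0 hθ0 hσ2 N
  set PG := posGibbsMeasure a₀ (hsDiameter σ N) (N + 1) with hPG
  haveI : IsProbabilityMeasure PG := isProbabilityMeasure_posGibbsMeasure ha ha0 hσ2 N
  set F : Config (N + 1) (Fin 3) T3 → T3 → ℝ := fun z x =>
    |empiricalDensityField z (g N x) - ρ₀ x| + ‖empiricalMomentumField z (g N x) - ρ₀ x • u₀ x‖ +
      |empiricalEnergyField z (g N x) - totalEnergyDensity (ρ₀ x) (u₀ x) (θ₀ x)| with hF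
  have hF0 : ∀ z x, 0 ≤ F z x := fun z x => by rw [hF]; positivity
  -- the uniform per-centre bound
  set Tot := δ₀ + 3 * (Real.sqrt ((((N + 1 : ℕ) : ℝ))⁻¹ * Cg N * Θ) * (1 + 2 * P.M) / 2 + τ₁ * (2 * P.M) + δ₀ * U) +
    (Real.sqrt ((((N + 1 : ℕ) : ℝ))⁻¹ * Cg N * B) * (1 + 2 * P.M) / 2 + τ₂ * (2 * P.M) + δ₀ * Ee) with hTot
  have hTotε : Tot ≤ ε := by
    rw [hTot]
    nlinarith [hδ₀le, hτ₁le, hτ₂le, hN3, hN4, hU0, hEe0, hδ₀.le]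
  have hmodu : ∀ x y, g N x y ≠ 0 → ‖u₀ y - u₀ x‖ ≤ τ₁ := fun x y hy => by
    have h := hϑ₁f ((hsupp N x y hy).trans (hN2.trans_le (min_le_left _ _)))
    rw [dist_eq_norm] at h
    exact h.le
  have hmode : ∀ x y, g N x y ≠ 0 → |e y - e x| ≤ τ₂ := fun x y hy => by
    have h := hϑ₂f ((hsupp N x y hy).trans (hN2.trans_le (min_le_right _ _)))
    rw [Real.dist_eq] at h
    exact h.le
  have hA1 : ∀ x, ∫ q, ((((N + 1 : ℕ) : ℝ))⁻¹ * ∑ i, g N x (q i)) ∂PG ≤ 2 * P.M := fun x =>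
    integral_avg_posGibbs_le ha ha0 hs N (hgm N x) (hg0 N x) (hgC N x) (hg1 N x)
  have hx : ∀ x, ∫⁻ z, ENNReal.ofReal (F z x) ∂LG ≤ ENNReal.ofReal Tot := by
    intro x
    have hm1 : Measurable fun z : Config (N + 1) (Fin 3) T3 => ENNReal.ofReal |empiricalDensityField z (g N x) - ρ₀ x| :=
      ((measurable_empiricalDensityField (hgm N x)).sub_const _).abs.ennreal_ofReal
    have hm2 : Measurable fun z : Config (N + 1) (Fin 3) T3 =>
        ENNReal.ofReal ‖empiricalMomentumField z (g N x) - ρ₀ x • u₀ x‖ :=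
      ((measurable_empiricalMomentumField (hgm N x)).sub_const _).norm.ennreal_ofReal
    have hsplit : ∀ z, ENNReal.ofReal (F z x) =
        ENNReal.ofReal |empiricalDensityField z (g N x) - ρ₀ x| +
          ENNReal.ofReal ‖empiricalMomentumField z (g N x) - ρ₀ x • u₀ x‖ +
          ENNReal.ofReal |empiricalEnergyField z (g N x) - ρ₀ x * e x| := fun z => by
      rw [hF]; dsimp only
      rw [ENNReal.ofReal_add (by positivity) (abs_nonneg _), ENNReal.ofReal_add (abs_nonneg _) (norm_nonneg _),
        totalEnergyDensity_eq]
    have hm12 : Measurable fun z : Config (N + 1) (Fin 3) T3 =>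
        ENNReal.ofReal |empiricalDensityField z (g N x) - ρ₀ x| +
          ENNReal.ofReal ‖empiricalMomentumField z (g N x) - ρ₀ x • u₀ x‖ := hm1.add hm2
    simp_rw [hsplit]
    rw [lintegral_add_left hm12, lintegral_add_left hm1]
    have h1 : ∫⁻ z, ENNReal.ofReal |empiricalDensityField z (g N x) - ρ₀ x| ∂LG ≤ ENNReal.ofReal δ₀ := by
      rw [hLG, lintegral_density_dev_eq ha hθ hu ha0 hθ0 hσ2 N (hgm N x) (hg0 N x) (hgC N x) (ρ₀ x)]
      exact ENNReal.ofReal_le_ofReal (hN1 x)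
    have h2 := lintegral_momentum_dev_le ha hθ hu ha0 hθ0 hσ2 N (hgm N x) (hg0 N x) (hgC N x)
      (ρ := ρ₀ x) hΘ hU hτ₁.le (hmodu x) (hA1 x) (hN1 x)
    have h3 := lintegral_energy_dev_le ha hθ hu ha0 hθ0 hσ2 N (hgm N x) (hg0 N x) (hgC N x)
      (ρ := ρ₀ x) hB hEe hτ₂.le (x := x) (fun y hy => hmode x y hy) (hA1 x) (hN1 x)
    calc _ ≤ ENNReal.ofReal δ₀ +
          ENNReal.ofReal (3 * (Real.sqrt ((((N + 1 : ℕ) : ℝ))⁻¹ * Cg N * Θ) * (1 + 2 * P.M) / 2 +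
            τ₁ * (2 * P.M) + δ₀ * U)) +
          ENNReal.ofReal (Real.sqrt ((((N + 1 : ℕ) : ℝ))⁻¹ * Cg N * B) * (1 + 2 * P.M) / 2 +
            τ₂ * (2 * P.M) + δ₀ * Ee) := add_le_add (add_le_add h1 h2) h3
      _ = ENNReal.ofReal Tot := by
          rw [hTot, ← ENNReal.ofReal_add hδ₀.le (by positivity), ← ENNReal.ofReal_add (by positivity) (by positivity)]
  -- joint measurability for Tonelli
  have hFm : Measurable fun p : Config (N + 1) (Fin 3) T3 × T3 => ENNReal.ofReal (F p.1 p.2) := by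
    rw [hF]
    refine Measurable.ennreal_ofReal ?_
    refine ((((measurable_empiricalDensityField_param (hgj N)).sub (hρc.measurable.comp measurable_snd)).abs.add
      ((measurable_empiricalMomentumField_param (hgj N)).sub ?_).norm).add
      ((measurable_empiricalEnergyField_param (hgj N)).sub ?_).abs)
    · exact (hρc.measurable.comp measurable_snd).smul (hu.measurable.comp measurable_snd)
    · have hc : Continuous fun x : T3 => totalEnergyDensity (ρ₀ x) (u₀ x) (θ₀ x) := by
        unfold totalEnergyDensity; fun_prop
      exact hc.measurable.comp measurable_snd
  -- conclusion
  calc ∫⁻ z, ENNReal.ofReal (∫ x, F z x) ∂LG ≤ ∫⁻ z, ∫⁻ x, ENNReal.ofReal (F z x) ∂volume ∂LG :=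
        lintegral_mono fun z => ofReal_integral_le_lintegral_ofReal' (hF0 z)
    _ = ∫⁻ x, ∫⁻ z, ENNReal.ofReal (F z x) ∂LG ∂volume := lintegral_lintegral_swap hFm.aemeasurable
    _ ≤ ∫⁻ _x : T3, ENNReal.ofReal Tot ∂volume := lintegral_mono fun x => hx x
    _ = ENNReal.ofReal Tot := by rw [lintegral_const, measure_univ, mul_one]
    _ ≤ ENNReal.ofReal ε := ENNReal.ofReal_le_ofReal hTotε

end LGFS
end Summit.AtomisticToContinuum.HydrodynamicLimit.Theorems
end
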